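import Summits.QuantumFields.BalabanUV.Beta.GAN24.FibreRateTBlockRate

/-!
# `BalabanUV.Beta.GAN24.FibreRateTBlockLabel` — binder row G-an2-4 / (CONV-C), road P1-fibre, self-row **P1-Y11t\*** (sub-part of p1 row L11,
# division agreed with the L11 owner in CLAIMS l.3039/l.3094), part 3: PER-LABEL bound and two-level RATE of the normalised T-summand

NOT IN PRINT; OUR PROOF ATTEMPT.  HONEST FRAMING (cell contract, verbatim): «discharging `BetaPertH` makes Bałaban's UV stability
UNCONDITIONAL — a real constructive-QFT result; it is NOT the continuum limit and NOT the Clay problem.»  HONEST DEPENDENCY (verbatim):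
«continuum YM on T⁴ ⇐ BetaPertH ∧ nine spine estimates (0/9 proved); BetaPertH ⇐ (D1) ∧ (D4) ∧ CAP+tail; G-an2-4 gates asym, D1 and
NE2/3/4.»  [folklore] product telescoping with majorants over the factorisation of part 1 (`FibreRateTBlock.tTerm_factor`) and the
per-coordinate engine of part 2 (`FibreRateTBlockRate`), `ReadingWeightRatesSum.abs_prod_sub_prod_le_sum` and
`ClosedFormRateOfParts.norm_mul_sub_mul_le` BY NAME; four harmless data `def`s (`phFac`, `pFac`, `xFac` = the three factors of part 1's
factorisation, `tNorm` = the normalised T-summand `N^{D−2}·tTerm`); NO cited fact, NO `def … : Prop`, NO wall binder, NO unit re-typed.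
NOT summit progress; nothing of (CONV-C)'s K-slot is discharged here.

## What is proved (real `pr ∈ [−π,π]^D`, label `q = qlab pr m`, `N = M·Lc ≥ 2`, `M, Lc ≥ 1`, next level `N′ = N·Lc`, `M′ = N`; pure-number constants, c3)
* §1 `tNorm := N^D·tTerm/N² = phFac · (pFac · xFac)` (`tNorm_eq`), `‖phFac‖ = 1`.
* §2 `0 ≤ pFac ≤ Π_i wMaj Lc (q_i)` and `|pFac_{N′,M′} − pFac_{N,M}| ≤ (6·momSq q/N²)·Π_i wMaj Lc (q_i)`.
* §3 `‖xFac‖ ≤ 666/momSq q` and `‖xFac_{N′,M′} − xFac_{N,M}‖ ≤ 280152/N²` (`q ≠ 0`; both levels on the extended zone).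
* §4 **`norm_tNorm_le`**: `‖tNorm‖ ≤ 666·(Π_i wMaj Lc (q_i))/momSq q` (`q ≠ 0`; the `m = 0` label keeps its `1/|p|²` pole — cancelled only by
  the capacitance feed, NOT here) and **`norm_tNorm_two_level_le`**: `‖tNorm_{N′,M′}(lift m) − tNorm_{N,M}(m)‖ ≤ 284148·(Π_i wMaj Lc (q_i))/N²`
  for EVERY label (the rate is `p`-UNIFORM although the summand is not: King's relative reciprocal rate pays the pole).
Consumers: part 4 `GAN24/FibreRateTBlockSum` (matched sum + tail ⇒ `‖𝔅_{N·Lc} − 𝔅_N‖ ≤ C_T/N²`), p1 row L11 `FibreRate` (leaf-20-g7).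
-/

noncomputable section

open Complex Finset
open scoped BigOperators Real
open Literature.Probability.LatticeModels (TorusSite)
open Literature.MathematicalPhysics.QuantumFieldTheory.King1986 (latticeSymbol momSq momSq_nonneg)
open Literature.MathematicalPhysics.QuantumFieldTheory.Balaban1983to89.B4Strip (ofRealVec)
open Summit.QuantumFields.BalabanUV.Beta.GAN24.AliasReindex (srep lift srep_lift natAbs_srep_le)
open Summit.QuantumFields.BalabanUV.Beta.GAN24.FibreRateTBlock (tTerm qlab rf rf_nonneg tTerm_factor)
open Summit.QuantumFields.BalabanUV.Beta.GAN24.FibreRateTBlockRate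

namespace Summit.QuantumFields.BalabanUV.Beta.GAN24.FibreRateTBlockLabel

variable {D : ℕ}

/-! ## §1 The three factors and the normalised T-summand -/

/-- [folklore] The LEVEL-FREE reading phase `e^{i q·(x′−y′)/Lc}`. -/
def phFac (Lc : ℕ) (q : Fin D → ℝ) (x' y' : Fin D → ℤ) : ℂ := cexp (I * ∑ i, ((q i / Lc : ℝ) : ℂ) * ((x' i : ℂ) - (y' i : ℂ)))

/-- [folklore] The product of squared reading factors `Π_i rf_{N,M}(q_i)²` (real, `≥ 0`). -/
def pFac (N M : ℕ) (q : Fin D → ℝ) : ℝ := ∏ i, rf N M (q i) ^ 2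

/-- [folklore] The bracket `[κ=l]·rf(q_κ)²/(2ℓ) − Lc²·(e^{iq_κ/Lc} − 1)(e^{−iq_l/Lc} − 1)/(2ℓ²)`, `ℓ = latticeSymbol N⁻¹ 0 q`. -/
def xFac (N M Lc : ℕ) (q : Fin D → ℝ) (κ l : Fin D) : ℂ :=
  (if κ = l then (((rf N M (q κ)) ^ 2 : ℝ) : ℂ) else 0) / (2 * ((latticeSymbol ((N : ℝ)⁻¹) 0 q : ℝ) : ℂ)) -
    (Lc : ℂ) ^ 2 * (cexp (I * ((q κ / Lc : ℝ) : ℂ)) - 1) * (cexp (-(I * ((q l / Lc : ℝ) : ℂ))) - 1) /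
      (2 * ((latticeSymbol ((N : ℝ)⁻¹) 0 q : ℝ) : ℂ) ^ 2)

/-- [folklore] THE NORMALISED T-SUMMAND `tNorm := N^D · tTerm / N²` (`= N^{D−2}·tTerm`; at `D = 4` with `s_f = M` the ff T-share is `Lc⁻²·Σ_m tNorm`). -/
def tNorm (N M : ℕ) [NeZero N] (pr : Fin D → ℝ) (m : TorusSite D N) (κ l : Fin D) (x' y' : Fin D → ℤ) : ℂ :=
  (N : ℂ) ^ D * tTerm N M (ofRealVec pr) m κ l x' y' / (N : ℂ) ^ 2

/-- [folklore] **`tNorm = phFac · (pFac · xFac)`** (part 1's `tTerm_factor`, divided by `N²`). -/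
theorem tNorm_eq {N M Lc : ℕ} [NeZero N] (hLc : Lc ≠ 0) (hM : M ≠ 0) (hNM : N = M * Lc) (pr : Fin D → ℝ) (m : TorusSite D N)
    (κ l : Fin D) (x' y' : Fin D → ℤ) :
    tNorm N M pr m κ l x' y' = phFac Lc (qlab pr m) x' y' * (((pFac N M (qlab pr m) : ℝ) : ℂ) * xFac N M Lc (qlab pr m) κ l) := by
  have hN : (N : ℂ) ≠ 0 := Nat.cast_ne_zero.2 (NeZero.ne N)
  unfold tNorm
  rw [tTerm_factor hLc hM hNM]
  unfold phFac pFac xFac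
  field_simp

/-- [folklore] The phase is unimodular. -/
theorem norm_phFac (Lc : ℕ) (q : Fin D → ℝ) (x' y' : Fin D → ℤ) : ‖phFac Lc q x' y'‖ = 1 := by
  unfold phFac
  have h : ∑ i, ((q i / Lc : ℝ) : ℂ) * ((x' i : ℂ) - (y' i : ℂ)) = ((∑ i, q i / Lc * ((x' i : ℝ) - y' i) : ℝ) : ℂ) := by
    push_cast; rfl
  rw [h, Complex.norm_exp_I_mul_ofReal]

/-! ## §2 The reading product -/

section Label

variable {N M Lc : ℕ}

/-- [folklore] `0 ≤ pFac`. -/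
theorem pFac_nonneg (N M : ℕ) (q : Fin D → ℝ) : 0 ≤ pFac N M q := Finset.prod_nonneg fun _ _ => sq_nonneg _

/-- [folklore] `pFac ≤ Π_i wMaj Lc (q_i)` on the extended zone (`N = M·Lc`). -/
theorem pFac_le (hM : 0 < M) (hLc : 0 < Lc) (hNM : N = M * Lc) {q : Fin D → ℝ} (hq : ∀ i, |q i| ≤ 5 * π / 3 * (N : ℝ)) :
    pFac N M q ≤ ∏ i, wMaj Lc (q i) :=
  Finset.prod_le_prod (fun _ _ => sq_nonneg _) fun i _ => rf_sq_le_wMaj hM hLc hNM (hq i)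

/-- [folklore] **TWO-LEVEL RATE OF THE READING PRODUCT**: `|pFac_{N·Lc,N}(q) − pFac_{N,M}(q)| ≤ (6·momSq q/N²)·Π_i wMaj Lc (q_i)`. -/
theorem abs_pFac_two_level_le (hM : 0 < M) (hLc : 0 < Lc) (hNM : N = M * Lc) {q : Fin D → ℝ} (hq : ∀ i, |q i| ≤ 5 * π / 3 * (N : ℝ)) :
    |pFac (N * Lc) N q - pFac N M q| ≤ 6 * momSq q / (N : ℝ) ^ 2 * ∏ i, wMaj Lc (q i) := by
  classical
  have hN : 0 < N := by rw [hNM]; exact Nat.mul_pos hM hLc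
  have hNN' : (N : ℝ) ≤ ((N * Lc : ℕ) : ℝ) := by exact_mod_cast Nat.le_mul_of_pos_right N hLc
  have hq' : ∀ i, |q i| ≤ 5 * π / 3 * ((N * Lc : ℕ) : ℝ) := fun i => zone_mono hNN' (hq i)
  unfold pFac
  have ha : ∀ j ∈ (Finset.univ : Finset (Fin D)), |rf (N * Lc) N (q j) ^ 2| ≤ wMaj Lc (q j) := fun j _ => by
    rw [abs_of_nonneg (sq_nonneg _)]; exact rf_sq_le_wMaj hN hLc rfl (hq' j)
  have hb : ∀ j ∈ (Finset.univ : Finset (Fin D)), |rf N M (q j) ^ 2| ≤ wMaj Lc (q j) := fun j _ => by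
    rw [abs_of_nonneg (sq_nonneg _)]; exact rf_sq_le_wMaj hM hLc hNM (hq j)
  refine (ReadingWeightRatesSum.abs_prod_sub_prod_le_sum Finset.univ _ _ _ ha hb).trans ?_
  calc ∑ i, |rf (N * Lc) N (q i) ^ 2 - rf N M (q i) ^ 2| * ∏ j ∈ Finset.univ.erase i, wMaj Lc (q j)
      ≤ ∑ i, (6 * q i ^ 2 / (N : ℝ) ^ 2 * wMaj Lc (q i)) * ∏ j ∈ Finset.univ.erase i, wMaj Lc (q j) :=
        Finset.sum_le_sum fun i _ => mul_le_mul_of_nonneg_right (abs_rf_sq_two_level_le hM hLc hNM (hq i))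
          (Finset.prod_nonneg fun j _ => wMaj_nonneg _ _)
    _ = ∑ i, 6 * q i ^ 2 / (N : ℝ) ^ 2 * ∏ j, wMaj Lc (q j) := by
        refine Finset.sum_congr rfl fun i _ => ?_
        rw [mul_assoc, Finset.mul_prod_erase Finset.univ (fun j => wMaj Lc (q j)) (Finset.mem_univ i)]
    _ = 6 * momSq q / (N : ℝ) ^ 2 * ∏ i, wMaj Lc (q i) := by
        rw [← Finset.sum_mul]
        congr 1
        rw [momSq, Finset.mul_sum, Finset.sum_div]

/-! ## §3 The bracket -/

/-- [folklore] `‖e^{ix} − 1‖ ≤ |x|`. -/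
theorem norm_cexp_sub_one_le (x : ℝ) : ‖cexp (I * (x : ℂ)) - 1‖ ≤ |x| := by
  have h := @Real.norm_exp_I_mul_ofReal_sub_one_le x
  rwa [Real.norm_eq_abs] at h

/-- [folklore] `‖e^{−ix} − 1‖ ≤ |x|`. -/
theorem norm_cexp_neg_sub_one_le (x : ℝ) : ‖cexp (-(I * (x : ℂ))) - 1‖ ≤ |x| := by
  have h := norm_cexp_sub_one_le (-x)
  rw [abs_neg] at h
  have e : -(I * (x : ℂ)) = I * ((-x : ℝ) : ℂ) := by push_cast; ring
  rwa [e]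

/-- [folklore] `|q_κ|·|q_l| ≤ momSq q`. -/
theorem abs_mul_abs_le_momSq (q : Fin D → ℝ) (κ l : Fin D) : |q κ| * |q l| ≤ momSq q := by
  have hκ : q κ ^ 2 ≤ momSq q := Finset.single_le_sum (fun j _ => sq_nonneg (q j)) (Finset.mem_univ κ)
  have hl : q l ^ 2 ≤ momSq q := Finset.single_le_sum (fun j _ => sq_nonneg (q j)) (Finset.mem_univ l)
  nlinarith [sq_nonneg (|q κ| - |q l|), sq_abs (q κ), sq_abs (q l), abs_nonneg (q κ), abs_nonneg (q l)]

/-- [folklore] The level-free numerator: `Lc²·‖e^{iq_κ/Lc} − 1‖·‖e^{−iq_l/Lc} − 1‖ ≤ momSq q`. -/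
theorem sq_mul_norm_num_le (hLc : 0 < Lc) (q : Fin D → ℝ) (κ l : Fin D) :
    (Lc : ℝ) ^ 2 * (‖cexp (I * ((q κ / Lc : ℝ) : ℂ)) - 1‖ * ‖cexp (-(I * ((q l / Lc : ℝ) : ℂ))) - 1‖) ≤ momSq q := by
  have hLc' : (0 : ℝ) < Lc := by exact_mod_cast hLc
  have h1 := norm_cexp_sub_one_le (q κ / Lc)
  have h2 := norm_cexp_neg_sub_one_le (q l / Lc)
  rw [abs_div, abs_of_pos hLc'] at h1 h2
  calc (Lc : ℝ) ^ 2 * (‖cexp (I * ((q κ / Lc : ℝ) : ℂ)) - 1‖ * ‖cexp (-(I * ((q l / Lc : ℝ) : ℂ))) - 1‖)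
      ≤ (Lc : ℝ) ^ 2 * (|q κ| / Lc * (|q l| / Lc)) := by gcongr
    _ = |q κ| * |q l| := by field_simp
    _ ≤ momSq q := abs_mul_abs_le_momSq q κ l

/-- [folklore] **BOUND OF THE BRACKET**: `‖xFac‖ ≤ 666/momSq q` on the extended zone (`q ≠ 0`):
`rf²/(2ℓ) ≤ 18/|q|²` and `Lc²|a||ā|/(2ℓ²) ≤ |q|²·648/|q|⁴`. -/
theorem norm_xFac_le (hM : 0 < M) (hLc : 0 < Lc) (hNM : N = M * Lc) {q : Fin D → ℝ} (hq : ∀ i, |q i| ≤ 5 * π / 3 * (N : ℝ)) (hq0 : q ≠ 0)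
    (κ l : Fin D) : ‖xFac N M Lc q κ l‖ ≤ 666 / momSq q := by
  have hN : 0 < N := by rw [hNM]; exact Nat.mul_pos hM hLc
  have hN' : (0 : ℝ) < N := by exact_mod_cast hN
  have hl := ell_pos hN' hq hq0
  have hil := inv_ell_le hN' hq hq0
  have hm : 0 < momSq q := lt_of_lt_of_le hl (ell_le_momSq hN'.ne' q)
  set ℓ := latticeSymbol ((N : ℝ)⁻¹) 0 q with hℓ
  have hnum := sq_mul_norm_num_le hLc q κ l
  -- the two summands
  have h1 : ‖(if κ = l then (((rf N M (q κ)) ^ 2 : ℝ) : ℂ) else 0) / (2 * (ℓ : ℂ))‖ ≤ 18 / momSq q := by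
    rw [norm_div, Complex.norm_mul, Complex.norm_ofNat, Complex.norm_real, Real.norm_eq_abs, abs_of_pos hl]
    have hδ : ‖(if κ = l then (((rf N M (q κ)) ^ 2 : ℝ) : ℂ) else 0)‖ ≤ 1 := by
      split_ifs
      · rw [Complex.norm_real, Real.norm_eq_abs, abs_of_nonneg (sq_nonneg _)]; exact rf_sq_le_one _ _ _
      · simp
    calc ‖(if κ = l then (((rf N M (q κ)) ^ 2 : ℝ) : ℂ) else 0)‖ / (2 * ℓ) ≤ 1 / (2 * ℓ) := by gcongr
      _ = (1 / 2) * ℓ⁻¹ := by rw [inv_eq_one_div]; field_simp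
      _ ≤ (1 / 2) * (36 / momSq q) := by gcongr
      _ = 18 / momSq q := by ring
  have h2 : ‖(Lc : ℂ) ^ 2 * (cexp (I * ((q κ / Lc : ℝ) : ℂ)) - 1) * (cexp (-(I * ((q l / Lc : ℝ) : ℂ))) - 1) / (2 * (ℓ : ℂ) ^ 2)‖
      ≤ 648 / momSq q := by
    rw [norm_div, Complex.norm_mul, Complex.norm_mul, Complex.norm_pow, Complex.norm_natCast, Complex.norm_mul, Complex.norm_ofNat,
      Complex.norm_pow, Complex.norm_real, Real.norm_eq_abs, abs_of_pos hl, mul_assoc]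
    have hl2 : (ℓ ^ 2)⁻¹ ≤ (36 / momSq q) ^ 2 := by
      rw [← inv_pow]; exact pow_le_pow_left₀ (inv_nonneg.2 hl.le) hil 2
    calc (Lc : ℝ) ^ 2 * (‖cexp (I * ((q κ / Lc : ℝ) : ℂ)) - 1‖ * ‖cexp (-(I * ((q l / Lc : ℝ) : ℂ))) - 1‖) / (2 * ℓ ^ 2)
        = (Lc : ℝ) ^ 2 * (‖cexp (I * ((q κ / Lc : ℝ) : ℂ)) - 1‖ * ‖cexp (-(I * ((q l / Lc : ℝ) : ℂ))) - 1‖) * ((1 / 2) * (ℓ ^ 2)⁻¹) := by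
          field_simp
      _ ≤ momSq q * ((1 / 2) * (36 / momSq q) ^ 2) := by gcongr
      _ = 648 / momSq q := by field_simp; ring
  unfold xFac
  rw [← hℓ]
  have e : (18 : ℝ) / momSq q + 648 / momSq q = 666 / momSq q := by ring
  exact (norm_sub_le _ _).trans (by linarith)

/-- [folklore] **TWO-LEVEL RATE OF THE BRACKET**: `‖xFac_{N·Lc,N} − xFac_{N,M}‖ ≤ 280152/N²` on the extended zone (`q ≠ 0`). -/
theorem norm_xFac_two_level_le (hM : 0 < M) (hLc : 0 < Lc) (hNM : N = M * Lc) {q : Fin D → ℝ} (hq : ∀ i, |q i| ≤ 5 * π / 3 * (N : ℝ))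
    (hq0 : q ≠ 0) (κ l : Fin D) : ‖xFac (N * Lc) N Lc q κ l - xFac N M Lc q κ l‖ ≤ 280152 / (N : ℝ) ^ 2 := by
  have hN : 0 < N := by rw [hNM]; exact Nat.mul_pos hM hLc
  have hN' : (0 : ℝ) < N := by exact_mod_cast hN
  have hNN' : (N : ℝ) ≤ ((N * Lc : ℕ) : ℝ) := by exact_mod_cast Nat.le_mul_of_pos_right N hLc
  have hq' : ∀ i, |q i| ≤ 5 * π / 3 * ((N * Lc : ℕ) : ℝ) := fun i => zone_mono hNN' (hq i)
  have hl := ell_pos hN' hq hq0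
  have hl' := ell_pos (lt_of_lt_of_le hN' hNN') hq' hq0
  have hil := inv_ell_le hN' hq hq0
  have hil' := inv_ell_le (lt_of_lt_of_le hN' hNN') hq' hq0
  have hm : 0 < momSq q := lt_of_lt_of_le hl (ell_le_momSq hN'.ne' q)
  have hrl := abs_inv_ell_two_level_le hN' hNN' hq hq0
  have hrl2 := abs_inv_sq_ell_two_level_le hN' hNN' hq hq0
  have hrr := abs_rf_sq_two_level_le hM hLc hNM (hq κ)
  have hw1 : wMaj Lc (q κ) ≤ 1 := wMaj_le_one _ _
  have hqκ : q κ ^ 2 ≤ momSq q := Finset.single_le_sum (fun j _ => sq_nonneg (q j)) (Finset.mem_univ κ)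
  have hnum := sq_mul_norm_num_le hLc q κ l
  set ℓ := latticeSymbol ((N : ℝ)⁻¹) 0 q with hℓ
  set ℓ' := latticeSymbol (((N * Lc : ℕ) : ℝ)⁻¹) 0 q with hℓ'
  set a := cexp (I * ((q κ / Lc : ℝ) : ℂ)) - 1 with ha
  set b := cexp (-(I * ((q l / Lc : ℝ) : ℂ))) - 1 with hb
  -- δ-part: real computation
  have hδ : ‖(if κ = l then (((rf (N * Lc) N (q κ)) ^ 2 : ℝ) : ℂ) else 0) / (2 * (ℓ' : ℂ)) -
      (if κ = l then (((rf N M (q κ)) ^ 2 : ℝ) : ℂ) else 0) / (2 * (ℓ : ℂ))‖ ≤ 216 / (N : ℝ) ^ 2 := by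
    split_ifs with hκl
    · have e : (((rf (N * Lc) N (q κ)) ^ 2 : ℝ) : ℂ) / (2 * (ℓ' : ℂ)) - (((rf N M (q κ)) ^ 2 : ℝ) : ℂ) / (2 * (ℓ : ℂ)) =
          (((rf (N * Lc) N (q κ) ^ 2 / (2 * ℓ') - rf N M (q κ) ^ 2 / (2 * ℓ) : ℝ)) : ℂ) := by push_cast; ring
      rw [e, Complex.norm_real, Real.norm_eq_abs]
      -- r'²/(2ℓ') − r²/(2ℓ) = (r'² − r²)/(2ℓ') + r²(1/(2ℓ') − 1/(2ℓ))
      have e2 : rf (N * Lc) N (q κ) ^ 2 / (2 * ℓ') - rf N M (q κ) ^ 2 / (2 * ℓ) =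
          (rf (N * Lc) N (q κ) ^ 2 - rf N M (q κ) ^ 2) * ((1 / 2) * ℓ'⁻¹) + rf N M (q κ) ^ 2 * ((1 / 2) * (ℓ'⁻¹ - ℓ⁻¹)) := by
        field_simp; ring
      rw [e2]
      have hr1 := rf_sq_le_one N M (q κ)
      have h6 : 0 ≤ 6 * q κ ^ 2 / (N : ℝ) ^ 2 * wMaj Lc (q κ) := by have := wMaj_nonneg Lc (q κ); positivity
      have t1 : |(rf (N * Lc) N (q κ) ^ 2 - rf N M (q κ) ^ 2) * (1 / 2 * ℓ'⁻¹)| ≤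
          (6 * q κ ^ 2 / (N : ℝ) ^ 2 * wMaj Lc (q κ)) * (1 / 2 * (36 / momSq q)) := by
        rw [abs_mul, abs_of_nonneg (by positivity : (0:ℝ) ≤ 1 / 2 * ℓ'⁻¹)]
        gcongr
      have t2 : |rf N M (q κ) ^ 2 * (1 / 2 * (ℓ'⁻¹ - ℓ⁻¹))| ≤ 1 * (1 / 2 * (216 / (N : ℝ) ^ 2)) := by
        rw [abs_mul, abs_of_nonneg (sq_nonneg _), abs_mul, abs_of_nonneg (by norm_num : (0:ℝ) ≤ 1 / 2)]
        exact mul_le_mul hr1 (mul_le_mul_of_nonneg_left hrl (by norm_num)) (by positivity) zero_le_one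
      refine ((abs_add_le _ _).trans (add_le_add t1 t2)).trans ?_
      have t3 : 6 * q κ ^ 2 / (N : ℝ) ^ 2 * wMaj Lc (q κ) ≤ 6 * momSq q / (N : ℝ) ^ 2 * 1 :=
        mul_le_mul (by gcongr) hw1 (wMaj_nonneg _ _) (by positivity)
      calc (6 * q κ ^ 2 / (N : ℝ) ^ 2 * wMaj Lc (q κ)) * (1 / 2 * (36 / momSq q)) + 1 * (1 / 2 * (216 / (N : ℝ) ^ 2))
          ≤ (6 * momSq q / (N : ℝ) ^ 2 * 1) * (1 / 2 * (36 / momSq q)) + 1 * (1 / 2 * (216 / (N : ℝ) ^ 2)) :=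
            add_le_add (mul_le_mul_of_nonneg_right t3 (by positivity : (0:ℝ) ≤ 1 / 2 * (36 / momSq q))) le_rfl
        _ = 216 / (N : ℝ) ^ 2 := by field_simp; ring
    · have h0 : (0 : ℝ) ≤ 216 / (N : ℝ) ^ 2 := by positivity
      calc _ = (0 : ℝ) := by simp
        _ ≤ _ := h0
  -- projector part
  have hP : ‖(Lc : ℂ) ^ 2 * a * b / (2 * (ℓ' : ℂ) ^ 2) - (Lc : ℂ) ^ 2 * a * b / (2 * (ℓ : ℂ) ^ 2)‖ ≤ 279936 / (N : ℝ) ^ 2 := by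
    have e : (Lc : ℂ) ^ 2 * a * b / (2 * (ℓ' : ℂ) ^ 2) - (Lc : ℂ) ^ 2 * a * b / (2 * (ℓ : ℂ) ^ 2) =
        (Lc : ℂ) ^ 2 * a * b * (((1 / 2) * ((ℓ' ^ 2)⁻¹ - (ℓ ^ 2)⁻¹) : ℝ) : ℂ) := by
      push_cast; field_simp
    rw [e, Complex.norm_mul, Complex.norm_mul, Complex.norm_mul, Complex.norm_pow, Complex.norm_natCast, Complex.norm_real,
      Real.norm_eq_abs, abs_mul, abs_of_nonneg (by norm_num : (0:ℝ) ≤ 1 / 2), mul_assoc ((Lc : ℝ) ^ 2)]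
    calc (Lc : ℝ) ^ 2 * (‖a‖ * ‖b‖) * (1 / 2 * |(ℓ' ^ 2)⁻¹ - (ℓ ^ 2)⁻¹|) ≤ momSq q * (1 / 2 * (559872 / ((N : ℝ) ^ 2 * momSq q))) := by
          gcongr
      _ = 279936 / (N : ℝ) ^ 2 := by field_simp; ring
  unfold xFac
  rw [← hℓ, ← hℓ', ← ha, ← hb]
  have e3 : ∀ (A B C E : ℂ), A - B - (C - E) = (A - C) - (B - E) := fun A B C E => by ring
  rw [e3]
  have e4 : (216 : ℝ) / (N : ℝ) ^ 2 + 279936 / (N : ℝ) ^ 2 = 280152 / (N : ℝ) ^ 2 := by ring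
  exact (norm_sub_le _ _).trans (by linarith)

/-! ## §4 The normalised T-summand: bound and two-level rate per label -/

/-- [folklore] The label of a class lies in the extended zone (`|pr_i| ≤ π`, `N ≥ 2`). -/
theorem qlab_zone [NeZero N] (hN2 : 2 ≤ N) {pr : Fin D → ℝ} (hpr : ∀ i, |pr i| ≤ π) (m : TorusSite D N) (i : Fin D) :
    |qlab pr m i| ≤ 5 * π / 3 * (N : ℝ) :=
  label_zone hN2 (hpr i) (natAbs_srep_le m i)

/-- [folklore] **PER-LABEL BOUND**: `‖tNorm(m)‖ ≤ 666·(Π_i wMaj Lc (q_i))/momSq q` for a label `q = qlab pr m ≠ 0`. -/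
theorem norm_tNorm_le [NeZero N] (hN2 : 2 ≤ N) (hM : 0 < M) (hLc : 0 < Lc) (hNM : N = M * Lc) {pr : Fin D → ℝ} (hpr : ∀ i, |pr i| ≤ π)
    (m : TorusSite D N) (hq0 : qlab pr m ≠ 0) (κ l : Fin D) (x' y' : Fin D → ℤ) :
    ‖tNorm N M pr m κ l x' y'‖ ≤ 666 * (∏ i, wMaj Lc (qlab pr m i)) / momSq (qlab pr m) := by
  have hq := qlab_zone hN2 hpr m
  rw [tNorm_eq hLc.ne' hM.ne' hNM, norm_mul, norm_phFac, one_mul, norm_mul, Complex.norm_real, Real.norm_eq_abs,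
    abs_of_nonneg (pFac_nonneg _ _ _)]
  have h1 := pFac_le hM hLc hNM hq
  have h2 := norm_xFac_le hM hLc hNM hq hq0 κ l
  have hm : 0 ≤ momSq (qlab pr m) := momSq_nonneg _
  calc pFac N M (qlab pr m) * ‖xFac N M Lc (qlab pr m) κ l‖ ≤ (∏ i, wMaj Lc (qlab pr m i)) * (666 / momSq (qlab pr m)) :=
        mul_le_mul h1 h2 (norm_nonneg _) (Finset.prod_nonneg fun i _ => wMaj_nonneg _ _)
    _ = _ := by ring

/-- [folklore] **PER-LABEL TWO-LEVEL RATE** (matched through `AliasReindex.lift`, so the label `q` is THE SAME at both levels):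
`‖tNorm_{N·Lc,N}(lift m) − tNorm_{N,M}(m)‖ ≤ 284148·(Π_i wMaj Lc (q_i))/N²` for EVERY class `m` (the zero label included). -/
theorem norm_tNorm_two_level_le [NeZero N] [NeZero (N * Lc)] (hN2 : 2 ≤ N) (hM : 0 < M) (hLc : 0 < Lc) (hNM : N = M * Lc)
    {pr : Fin D → ℝ} (hpr : ∀ i, |pr i| ≤ π) (m : TorusSite D N) (κ l : Fin D) (x' y' : Fin D → ℤ) :
    ‖tNorm (N * Lc) N pr (lift (N * Lc) m) κ l x' y' - tNorm N M pr m κ l x' y'‖ ≤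
      284148 * (∏ i, wMaj Lc (qlab pr m i)) / (N : ℝ) ^ 2 := by
  have hN : 0 < N := by omega
  have hNLc : N ≤ N * Lc := Nat.le_mul_of_pos_right N hLc
  have hq := qlab_zone hN2 hpr m
  have hlab : qlab pr (lift (N * Lc) m) = qlab pr m := by
    funext i; simp only [qlab, srep_lift hNLc]
  have hW0 : 0 ≤ ∏ i, wMaj Lc (qlab pr m i) := Finset.prod_nonneg fun i _ => wMaj_nonneg _ _
  rw [tNorm_eq hLc.ne' hN.ne' rfl, tNorm_eq hLc.ne' hM.ne' hNM, hlab, ← mul_sub, norm_mul, norm_phFac, one_mul]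
  rcases eq_or_ne (qlab pr m) 0 with hq0 | hq0
  · -- the zero label: `ℓ = 0`, both brackets vanish
    have hx : ∀ N' M' : ℕ, xFac N' M' Lc (qlab pr m) κ l = 0 := by
      intro N' M'
      unfold xFac
      have : latticeSymbol ((N' : ℝ)⁻¹) 0 (qlab pr m) = 0 := by
        rw [hq0]; unfold latticeSymbol; simp [Literature.MathematicalPhysics.QuantumFieldTheory.King1986.fdSymbol]
      rw [this]; simp
    rw [hx, hx]; simp only [mul_zero, sub_self, norm_zero]; positivity
  have hP := abs_pFac_two_level_le hM hLc hNM hq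
  have hPb := pFac_le hM hLc hNM hq
  have hX := norm_xFac_two_level_le hM hLc hNM hq hq0 κ l
  have hNN' : (N : ℝ) ≤ ((N * Lc : ℕ) : ℝ) := by exact_mod_cast hNLc
  have hX'b := norm_xFac_le hN hLc rfl (fun i => zone_mono hNN' (hq i)) hq0 κ l
  have hm : 0 < momSq (qlab pr m) := by
    have hN' : (0:ℝ) < N := by exact_mod_cast hN
    exact lt_of_lt_of_le (ell_pos hN' hq hq0) (ell_le_momSq hN'.ne' _)
  have key := ClosedFormRateOfParts.norm_mul_sub_mul_le (((pFac N M (qlab pr m) : ℝ) : ℂ)) (((pFac (N * Lc) N (qlab pr m) : ℝ) : ℂ))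
    (xFac N M Lc (qlab pr m) κ l) (xFac (N * Lc) N Lc (qlab pr m) κ l)
  rw [← Complex.ofReal_sub, Complex.norm_real, Complex.norm_real, Real.norm_eq_abs, Real.norm_eq_abs,
    abs_of_nonneg (pFac_nonneg _ _ _)] at key
  refine key.trans ?_
  calc |pFac (N * Lc) N (qlab pr m) - pFac N M (qlab pr m)| * ‖xFac (N * Lc) N Lc (qlab pr m) κ l‖ +
        pFac N M (qlab pr m) * ‖xFac (N * Lc) N Lc (qlab pr m) κ l - xFac N M Lc (qlab pr m) κ l‖
      ≤ (6 * momSq (qlab pr m) / (N : ℝ) ^ 2 * ∏ i, wMaj Lc (qlab pr m i)) * (666 / momSq (qlab pr m)) +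
          (∏ i, wMaj Lc (qlab pr m i)) * (280152 / (N : ℝ) ^ 2) := by
        gcongr
    _ = 284148 * (∏ i, wMaj Lc (qlab pr m i)) / (N : ℝ) ^ 2 := by field_simp; ring

end Label

end Summit.QuantumFields.BalabanUV.Beta.GAN24.FibreRateTBlockLabel

end
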